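import Summits.BirchSwinnertonDyer.Rank1Residual.GaloisImage.HauptmodulFiveQuarticValuation
import HarnessLib

/-!
# The level-`9` Hauptmodul at `v₃(j) = 5` is VALUATION-FORCED: from `j(S − 27) = S(S − 24)³`,
# `v(S) = v(3)` and `θ³ = S` alone, `v((θ(S − 6)/9)² − 1)⁹ = v(3)²`
# (cell `b2b-bsdres`, team n1011, seat p02 gen 5 — row T-b11-F4, file F4c-H7 'Hauptmodul route,
# curve-free core at v₃(j) = 5, part 2'; pure valuation algebra in `ℚ̄`)

HONEST FRAMING (cell `b2b-bsdres`, run/shared/lean/b2b/bsd-rank1-residual/, verbatim in every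
file): the goal of the cell is to DELETE the COMBINATION-SHAPED residual classes of the
Birch–Swinnerton-Dyer formula for ALL analytic-rank `≤ 1` elliptic curves over `ℚ` — "full BSD
formula for every rank `≤ 1` curve in class `C`" assembled STRICTLY from published theorems — so
that the rank-`≤ 1` remainder becomes exactly the CONSTRUCTION-SHAPED classes, which are TYPED
(missing-input `Prop`s), NOT attempted. This is not "finishing BSD". Team n1011 (N10 / N11):
research route; no claim beyond the stated classes; labels UNCHANGED; nothing is booked. Theorems
only (no definition, no named fact).

## What this file proves

`v` the place of `ℚ̄` over `3`, `t = v(3)`.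

* `valuation_sub_one_le_or_add_one_le` (§0) — a rational `3`-adic unit `q` has `v(q − 1) ≤ t` or
  `v(q + 1) ≤ t`.
* `valuation_sub_one_pow_nine_of_cube_sq` (§1) — `v(X³ − 1)³ = t²` ⟹ `v(X − 1)⁹ = t²`.
* **`valuation_hauptmodul_nine_invariant_five_pow_nine`** (§2) — `j ∈ ℚ` with `v₃(j) = 5`,
  `S, θ ∈ ℚ̄` with `j(S − 27) = S(S − 24)³`, `v(S) = t`, `θ³ = S` ⟹
  **`v((θ(S − 6)/9)² − 1)⁹ = t²`**.  Proof: `ρ = S/3 − 2`, `K = j/3⁵`;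
  `(X³ − 1)·81(16 − ρ)² = F₋F₊` for `X = (θ(S − 6)/9)²` (`X³ = (2 + ρ)²ρ⁶/81`,
  `ρ³(16 − ρ) = 72ρ² − 9Kρ + 63K − 432`), and `v(F₋F₊) = t⁴v(ρ)`, `v(ρ)³ = t²`
  (`HauptmodulFiveQuarticValuation`), so `v(X³ − 1)³ = t²`.

For an elliptic curve `E/ℚ` with `v₃(j) = 5` (so `v₃(j − 1728) = 3`) and a cyclic `C ⊂ E[9]` over
a non-canonical `3`-torsion group, `θ = η(E, C) + 3` satisfies the hypotheses
(`HauptmodulNineInvariant`, `HauptmodulThreeShapeValuation`), so `z = (θ(θ³ − 6)/9)² − 1 ∈ ℚ(C)`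
is a `Stab(C)`-invariant with `v(z)⁹·v(3)⁰ = v(3)²`, `9` coprime to `0 − 2`: the scalar-stabiliser
tower criterion gives the `3`-adic tower from surj(3) on the family `v₃(j) = 5` of the EXOTIC core
(117 census cells; EVIDENCE kit j134538: `v(z) = 2/9` on 117/117).  Nothing booked.

References: [Maier2006] Table 4 (N = 3, 9), §5.
-/

noncomputable section

set_option maxRecDepth 10000

open scoped Classical

namespace Summit.BirchSwinnertonDyer.Rank1Residual.GaloisImage

open Literature.NumberTheory.EllipticCurves Literature.NumberTheory.GaloisRepresentations
  Rat.HeightOneSpectrum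

/-! ### §0 A rational `3`-adic unit is `≡ ±1 (mod 3)` -/

/-- For a rational `q` with `3 ∣ q` in the sense `1 ≤ v₃(q)` (or `q = 0`): `v(q) ≤ v(3)` in `ℚ̄`.
[folklore] -/
theorem valuation_algebraMap_le_three_of_padicValRat {q : ℚ} (h : q = 0 ∨ 1 ≤ padicValRat 3 q) :
    (placeOver 3).valuation (algebraMap ℚ (AlgebraicClosure ℚ) q) ≤
      (placeOver 3).valuation (3 : AlgebraicClosure ℚ) := by
  rcases h with h0 | h1
  · rw [h0, map_zero, map_zero]; exact zero_le
  · by_cases hq : q = 0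
    · rw [hq, map_zero, map_zero]; exact zero_le
    obtain ⟨m, hm⟩ : ∃ m : ℕ, padicValRat 3 q = m := ⟨(padicValRat 3 q).toNat, by omega⟩
    have hv := valuation_ratCast_eq_pow_of_padicValRat hq hm
    calc (placeOver 3).valuation (algebraMap ℚ (AlgebraicClosure ℚ) q)
        = (placeOver 3).valuation (3 : AlgebraicClosure ℚ) ^ m := hv
      _ ≤ (placeOver 3).valuation (3 : AlgebraicClosure ℚ) :=
          pow_le_of_le_one zero_le valuation_three_lt_one.le (by omega)

/-- **A rational `3`-adic unit is `±1 (mod 3)`**: for `q ∈ ℚ` with `q ≠ 0`, `v₃(q) = 0`, either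
`v(q − 1) ≤ v(3)` or `v(q + 1) ≤ v(3)` in `ℚ̄` (`3 ∣ (n − d)(n + d)` for `q = n/d`). [folklore] -/
theorem valuation_sub_one_le_or_add_one_le {q : ℚ} (hq : q ≠ 0) (hv : padicValRat 3 q = 0) :
    (placeOver 3).valuation (algebraMap ℚ (AlgebraicClosure ℚ) (q - 1)) ≤
        (placeOver 3).valuation (3 : AlgebraicClosure ℚ) ∨
      (placeOver 3).valuation (algebraMap ℚ (AlgebraicClosure ℚ) (q + 1)) ≤
        (placeOver 3).valuation (3 : AlgebraicClosure ℚ) := by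
  haveI : Fact (Nat.Prime 3) := ⟨Nat.prime_three⟩
  obtain ⟨hn, hd⟩ := not_dvd_num_den_of_padicValRat_eq_zero hq hv
  set n := q.num with hnq
  set d := (q.den : ℤ) with hdq
  have hd0 : (d : ℚ) ≠ 0 := by rw [hdq]; exact_mod_cast q.den_nz
  have hq' : q = (n : ℚ) / d := by rw [hnq, hdq]; exact_mod_cast (Rat.num_div_den q).symm
  have hvd : padicValRat 3 (d : ℚ) = 0 := by
    rw [hdq, Int.cast_natCast, padicValRat.of_nat, padicValNat.eq_zero_of_not_dvd hd]; rfl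
  -- `3 ∣ (n - d)(n + d) = n² - d²`
  have h3 : (3 : ℤ) ∣ (n - d) * (n + d) := by
    have hn3 : (n : ZMod 3) ≠ 0 := by
      rw [Ne, ZMod.intCast_zmod_eq_zero_iff_dvd]; exact_mod_cast hn
    have hd3 : (d : ZMod 3) ≠ 0 := by
      rw [Ne, ZMod.intCast_zmod_eq_zero_iff_dvd, hdq]; exact_mod_cast hd
    have h' : (((n - d) * (n + d) : ℤ) : ZMod 3) = 0 := by
      push_cast
      rw [show ((n : ZMod 3) - d) * (n + d) = (n : ZMod 3) ^ 2 - (d : ZMod 3) ^ 2 by ring,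
        sq_eq_one_of_ne_zero_zmod_three _ hn3, sq_eq_one_of_ne_zero_zmod_three _ hd3, sub_self]
    exact (ZMod.intCast_zmod_eq_zero_iff_dvd _ 3).mp h'
  -- the value of `q ∓ 1` from `n ∓ d`
  have key : ∀ e : ℤ, (3 : ℤ) ∣ e → (e : ℚ) / d = 0 ∨ 1 ≤ padicValRat 3 ((e : ℚ) / d) := by
    intro e he
    by_cases he0 : e = 0
    · left; rw [he0]; simp
    · right
      have h1 : 1 ≤ padicValInt 3 e :=
        ((padicValInt_dvd_iff 1 e).mp (by simpa using he)).resolve_left he0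
      rw [padicValRat.div (by exact_mod_cast he0) hd0, hvd, padicValRat.of_int, sub_zero]
      exact_mod_cast h1
  rcases (Int.prime_three.dvd_mul).mp h3 with h | h
  · left
    have e : q - 1 = ((n - d : ℤ) : ℚ) / d := by rw [hq']; push_cast; field_simp
    rw [e]
    exact valuation_algebraMap_le_three_of_padicValRat (key _ h)
  · right
    have e : q + 1 = ((n + d : ℤ) : ℚ) / d := by rw [hq']; push_cast; field_simp
    rw [e]
    exact valuation_algebraMap_le_three_of_padicValRat (key _ h)

/-! ### §1 The cube-root lemma, exponent `2` -/

/-- **`v(X³ − 1) = v(3)^{2/3}` forces `v(X − 1) = v(3)^{2/9}`**: precisely `v(X³ − 1)³ = v(3)²`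
⟹ `v(X − 1)⁹ = v(3)²` (as `HauptmodulNineValuationFour.valuation_sub_one_pow_nine_of_cube`:
`X³ − 1 = (X − 1)(X − ω)(X − ω²)`, `v(1 − ω)² = v(3)`; if `v(X − 1) ≤ v(1 − ω)` the product would
be at most `v(3)^{3/2} < v(3)^{2/3}`). [folklore] -/
theorem valuation_sub_one_pow_nine_of_cube_sq {X : AlgebraicClosure ℚ}
    (h : (placeOver 3).valuation (X ^ 3 - 1) ^ 3 =
      (placeOver 3).valuation (3 : AlgebraicClosure ℚ) ^ 2) :
    (placeOver 3).valuation (X - 1) ^ 9 = (placeOver 3).valuation (3 : AlgebraicClosure ℚ) ^ 2 := by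
  set v := (placeOver 3).valuation with hv
  set t := v (3 : AlgebraicClosure ℚ) with ht
  have ht1 : t < 1 := valuation_three_lt_one
  have ht0 : t ≠ 0 := valuation_three_ne_zero
  have ht32 : t ^ 3 < t ^ 2 := (pow_lt_pow_iff_of_lt_one' ht0 ht1).mpr (by norm_num)
  have ht42 : t ^ 4 < t ^ 2 := (pow_lt_pow_iff_of_lt_one' ht0 ht1).mpr (by norm_num)
  -- a primitive cube root of unity `ω = (−1 + δ)/2`, `δ² = −3`
  obtain ⟨δ, hδ⟩ := IsAlgClosed.exists_pow_nat_eq (-3 : AlgebraicClosure ℚ) (by norm_num : 0 < 2)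
  set ω : AlgebraicClosure ℚ := (-1 + δ) / 2 with hω
  have hω2 : ω ^ 2 + ω + 1 = 0 := by
    rw [hω]; field_simp; linear_combination hδ
  have hfac : X ^ 3 - 1 = (X - 1) * ((X - ω) * (X - ω ^ 2)) := by
    linear_combination (X - 1) * (X - ω + 1) * hω2
  have h3 : (1 - ω) * (1 - ω ^ 2) = 3 := by linear_combination (ω - 2) * hω2
  have hω3 : ω ^ 3 = 1 := by linear_combination (ω - 1) * hω2
  have hvω : v ω = 1 := by
    have h1 : v ω ^ 3 = 1 := by rw [← map_pow, hω3, map_one]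
    rcases lt_trichotomy (v ω) 1 with hlt | heq | hgt
    · exact absurd h1 (ne_of_lt (pow_lt_one₀ zero_le hlt (by norm_num)))
    · exact heq
    · exact absurd h1 (ne_of_gt (one_lt_pow₀ hgt (by norm_num)))
  have hb : v (1 - ω ^ 2) = v (1 - ω) := by
    rw [show (1 : AlgebraicClosure ℚ) - ω ^ 2 = (1 - ω) * (1 + ω) by ring, map_mul,
      show (1 : AlgebraicClosure ℚ) + ω = -ω ^ 2 by linear_combination hω2, Valuation.map_neg, map_pow,
      hvω, one_pow, mul_one]
  set b := v (1 - ω) with hbdef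
  have hb2 : b ^ 2 = t := by
    have := congrArg v h3; rw [map_mul, hb] at this; rw [pow_two]; exact this
  have hb0 : b ≠ 0 := by intro h0; rw [h0, zero_pow two_ne_zero] at hb2; exact ht0 hb2.symm
  set a := v (X - 1) with ha
  have hprod : v (X ^ 3 - 1) = a * (v (X - ω) * v (X - ω ^ 2)) := by rw [hfac, map_mul, map_mul]
  -- compare `a` with `b`
  rcases lt_trichotomy a b with hab | hab | hab
  · -- `a < b`: then `v(X − ω) = v(X − ω²) = b` and `v(X³ − 1)³ = a³ t³ < t²`
    exfalso
    have e1 : v (X - ω) = b := by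
      rw [show X - ω = (X - 1) + (1 - ω) by ring]; exact Valuation.map_add_eq_of_lt_right _ hab
    have e2 : v (X - ω ^ 2) = b := by
      rw [show X - ω ^ 2 = (X - 1) + (1 - ω ^ 2) by ring, ← hb]
      exact Valuation.map_add_eq_of_lt_right _ (by rw [hb]; exact hab)
    rw [hprod, e1, e2] at h
    have hlt : (a * (b * b)) ^ 3 < t ^ 2 := by
      have hb1 : b < 1 := by
        by_contra hb1; rw [not_lt] at hb1
        have : 1 ≤ b ^ 2 := one_le_pow₀ hb1
        rw [hb2] at this; exact absurd ht1 (not_lt.mpr this)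
      calc (a * (b * b)) ^ 3 = a ^ 3 * t ^ 3 := by rw [← pow_two, hb2, mul_pow]
        _ ≤ 1 * t ^ 3 := mul_le_mul' (pow_le_one₀ zero_le (hab.trans hb1).le) le_rfl
        _ = t ^ 3 := one_mul _
        _ < t ^ 2 := ht32
    exact absurd h hlt.ne
  · -- `a = b`: `v(X³ − 1) ≤ b·t`, so `v(X³ − 1)³ ≤ t⁴ b < t²`
    exfalso
    have e1 : v (X - ω) ≤ b := by
      rw [show X - ω = (X - 1) + (1 - ω) by ring]
      exact (Valuation.map_add _ _ _).trans (max_le hab.le le_rfl)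
    have e2 : v (X - ω ^ 2) ≤ b := by
      rw [show X - ω ^ 2 = (X - 1) + (1 - ω ^ 2) by ring]
      exact (Valuation.map_add _ _ _).trans (max_le hab.le hb.le)
    have hle : v (X ^ 3 - 1) ≤ b * t := by
      rw [hprod, hab]
      calc b * (v (X - ω) * v (X - ω ^ 2)) ≤ b * (b * b) := mul_le_mul' le_rfl (mul_le_mul' e1 e2)
        _ = b * t := by rw [← pow_two, hb2]
    have : v (X ^ 3 - 1) ^ 3 ≤ (b * t) ^ 3 := pow_le_pow_left₀ zero_le hle 3
    rw [h] at this
    have hlt : (b * t) ^ 3 < t ^ 2 := by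
      have hb1 : b < 1 := by
        by_contra hb1; rw [not_lt] at hb1
        have : 1 ≤ b ^ 2 := one_le_pow₀ hb1
        rw [hb2] at this; exact absurd ht1 (not_lt.mpr this)
      calc (b * t) ^ 3 = t ^ 4 * b := by
            rw [mul_pow, show b ^ 3 = b * b ^ 2 from pow_succ' b 2, hb2]
            simp only [pow_succ, pow_zero, one_mul, mul_comm, mul_left_comm]
        _ ≤ t ^ 4 * 1 := mul_le_mul' le_rfl hb1.le
        _ = t ^ 4 := mul_one _
        _ < t ^ 2 := ht42
    exact absurd this (not_le.mpr hlt)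
  · -- `a > b`: all three factors have valuation `a`
    have e1 : v (X - ω) = a := by
      rw [show X - ω = (X - 1) + (1 - ω) by ring]; exact Valuation.map_add_eq_of_lt_left _ hab
    have e2 : v (X - ω ^ 2) = a := by
      rw [show X - ω ^ 2 = (X - 1) + (1 - ω ^ 2) by ring]
      exact Valuation.map_add_eq_of_lt_left _ (by rw [hb]; exact hab)
    rw [hprod, e1, e2] at h
    rw [← h]
    simp only [pow_succ, pow_zero, one_mul, mul_assoc]

/-! ### §2 Assembly at `v₃(j) = 5` -/

/-- **The level-`9` Hauptmodul at `v₃(j) = 5` is valuation-forced.**  Let `j ∈ ℚ` with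
`v₃(j) = 5`, and `S, θ ∈ ℚ̄` with `j(S − 27) = S(S − 24)³`, `v(S) = v(3)` and `θ³ = S`.  Then
**`v((θ(S − 6)/9)² − 1)⁹ = v(3)²`** — `3`-adic valuation exactly `2/9`.
[cite: Maier2006, Table 4 (N = 3, 9) and §5] -/
theorem valuation_hauptmodul_nine_invariant_five_pow_nine {j : ℚ} (hj : padicValRat 3 j = 5)
    {S θ : AlgebraicClosure ℚ}
    (hS : algebraMap ℚ (AlgebraicClosure ℚ) j * (S - 27) = S * (S - 24) ^ 3)
    (hvS : (placeOver 3).valuation S = (placeOver 3).valuation (3 : AlgebraicClosure ℚ))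
    (hθ : θ ^ 3 = S) :
    (placeOver 3).valuation ((θ * (S - 6) / 9) ^ 2 - 1) ^ 9 =
      (placeOver 3).valuation (3 : AlgebraicClosure ℚ) ^ 2 := by
  haveI : Fact (Nat.Prime 3) := ⟨Nat.prime_three⟩
  set v := (placeOver 3).valuation with hv
  set t := v (3 : AlgebraicClosure ℚ) with ht
  have ht1 : t < 1 := valuation_three_lt_one
  have ht0 : t ≠ 0 := valuation_three_ne_zero
  have h3 : (3 : AlgebraicClosure ℚ) ≠ 0 := by norm_num
  -- `K = j/3⁵`, a rational `3`-adic unit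
  have hj0 : j ≠ 0 := by
    intro h0; rw [h0, padicValRat.zero] at hj; norm_num at hj
  have hK0 : j / 243 ≠ 0 := div_ne_zero hj0 (by norm_num)
  have h33 : padicValRat 3 (3 : ℚ) = 1 := by exact_mod_cast padicValRat.self (p := 3) (by norm_num)
  have hKv : padicValRat 3 (j / 243) = 0 := by
    rw [padicValRat.div hj0 (by norm_num), hj, show (243 : ℚ) = 3 ^ 5 by norm_num,
      padicValRat.pow, h33]
    all_goals norm_num
  set K := algebraMap ℚ (AlgebraicClosure ℚ) (j / 243) with hKdef
  have hK : v K = 1 := by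
    have hm : padicValRat 3 (j / 243) = ((0 : ℕ) : ℤ) := by rw [hKv]; rfl
    have h := valuation_ratCast_eq_pow_of_padicValRat hK0 hm
    rw [pow_zero] at h
    exact h
  have hKpm : v (K - 1) ≤ t ∨ v (K + 1) ≤ t := by
    have h := valuation_sub_one_le_or_add_one_le hK0 hKv
    rw [map_sub, map_add, map_one] at h
    exact h
  have hjK : algebraMap ℚ (AlgebraicClosure ℚ) j = 243 * K := by
    rw [hKdef, map_div₀, map_ofNat, mul_div_cancel₀ _ (by norm_num : (243 : AlgebraicClosure ℚ) ≠ 0)]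
  -- `ρ = S/3 − 2`
  obtain ⟨ρ, hρS⟩ : ∃ ρ : AlgebraicClosure ℚ, S = 3 * ρ + 6 := ⟨S / 3 - 2, by field_simp; ring⟩
  subst hρS
  have hr : ρ ^ 4 - 16 * ρ ^ 3 + 72 * ρ ^ 2 - 9 * K * ρ + (63 * K - 432) = 0 := by
    have h := rho_quartic_of_hauptmodul_three hS
    rw [hjK] at h
    have e : (3 * ρ + 6) / 3 - 2 = ρ := by field_simp; ring
    rw [e] at h
    linear_combination h
  have hρ2 : v (ρ + 2) = 1 := by
    have e : ρ + 2 = (3 * ρ + 6) / 3 := by field_simp; ring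
    rw [e, map_div₀, hvS, div_self ht0]
  have hρ := valuation_rho_pow_three_eq_sq hK hρ2 hr
  set s := v ρ with hs
  have hF := valuation_factors_of_quartic_five hK hKpm hρ
  -- `v(16 − ρ) = 1`, `v(81) = t⁴`
  have hle1 : ∀ n : ℕ, v (n : AlgebraicClosure ℚ) ≤ 1 := fun n ↦
    ((placeOver 3).valuation_le_one_iff _).mpr (natCast_mem (placeOver 3) n)
  have h16ρ : v (16 - ρ) = 1 := by
    have e : (16 : AlgebraicClosure ℚ) - ρ = 18 - (ρ + 2) := by ring
    have hlt : v (18 : AlgebraicClosure ℚ) < v (ρ + 2) := by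
      rw [hρ2, show (18 : AlgebraicClosure ℚ) = 2 * 3 ^ 2 by norm_num, map_mul, map_pow]
      calc v 2 * t ^ 2 ≤ 1 * t ^ 2 := mul_le_mul' (by exact_mod_cast hle1 2) le_rfl
        _ = t ^ 2 := one_mul _
        _ < 1 := pow_lt_one₀ zero_le ht1 two_ne_zero
    rw [e, valuation_sub_eq_of_lt' hlt, hρ2]
  have h81 : v (81 : AlgebraicClosure ℚ) = t ^ 4 := by
    rw [show (81 : AlgebraicClosure ℚ) = 3 ^ 4 by norm_num, map_pow]
  -- the key identity `(X³ − 1)·81(16 − ρ)² = F₋ F₊`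
  have hθ6 : θ ^ 6 = 9 * (ρ + 2) ^ 2 := by
    rw [show θ ^ 6 = (θ ^ 3) ^ 2 by ring, hθ]; ring
  have hR : ρ ^ 3 * (16 - ρ) = 72 * ρ ^ 2 - 9 * K * ρ + 63 * K - 432 := by
    linear_combination -hr
  have hprod : (((θ * (3 * ρ + 6 - 6) / 9) ^ 2) ^ 3 - 1) * (81 * (16 - ρ) ^ 2) =
      (126 * (K - 8) + 9 * ρ * (5 * K - 47) + 9 * ρ ^ 2 * (16 - K) + 72 * ρ ^ 3) *
        (18 * (7 * K - 40) + 9 * ρ * (5 * K - 49) + 9 * ρ ^ 2 * (16 - K) + 72 * ρ ^ 3) := by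
    linear_combination (ρ ^ 6 * (16 - ρ) ^ 2 / 9) * hθ6 +
      ((ρ + 2) ^ 2 * (ρ ^ 3 * (16 - ρ) + (72 * ρ ^ 2 - 9 * K * ρ + 63 * K - 432))) * hR
  have hX3 : v (((θ * (3 * ρ + 6 - 6) / 9) ^ 2) ^ 3 - 1) = s := by
    have h := congrArg v hprod
    rw [map_mul, map_mul, map_mul, map_pow, h81, h16ρ, one_pow, mul_one, hF] at h
    -- `h : v(X³ − 1) * t⁴ = t⁴ * s`
    have ht4 : t ^ 4 ≠ 0 := pow_ne_zero _ ht0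
    calc v (((θ * (3 * ρ + 6 - 6) / 9) ^ 2) ^ 3 - 1)
        = v (((θ * (3 * ρ + 6 - 6) / 9) ^ 2) ^ 3 - 1) * t ^ 4 / t ^ 4 := by
          rw [mul_div_cancel_right₀ _ ht4]
      _ = s := by rw [h, mul_comm, mul_div_cancel_right₀ _ ht4]
  have hcube : v (((θ * (3 * ρ + 6 - 6) / 9) ^ 2) ^ 3 - 1) ^ 3 = t ^ 2 := by rw [hX3, hs, hρ]
  exact valuation_sub_one_pow_nine_of_cube_sq hcube

end Summit.BirchSwinnertonDyer.Rank1Residual.GaloisImage
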